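import Summits.NavierStokesRegularity.NavierStokesRegularity.Theorems.TypeICertificateLadderTargetStretchingNumber
import Summits.NavierStokesRegularity.NavierStokesRegularity.Theorems.TypeICertificateLadderTargetLambEnergySlack
import Summits.NavierStokesRegularity.NavierStokesRegularity.Theorems.DssFarFieldSlavingBlowupTypeIDssProfileSimilarityEnstrophyLambCore
import Literature.Analysis.FluidPDE.NearBeltramiEnstrophyCriterion
import HarnessLib

/-!
# Crux `Target` = `TypeICertificateLadder.NoTypeIBlowup` (stmt-NavierStokesRegularity-1217), line
# `depletion-ladder`: a Type-I singularity is frequently SUPERHELICITY-FREE up to `√(1 − 1/C²)`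

`--supports stmt-NavierStokesRegularity-1217` (line `depletion-ladder`; capstone of the per-solution
chain `…TargetStretchingSlice/Slab/Number` and of the superhelicity slack `…TargetLambHelicitySlack`,
`…TargetDepletionSuperhelicity`).

The vortex-stretching integral in Lamb form (tree: Farhat–Grujić's
`integral_stretching_eq_integral_inner_curl_cross`, `∫⟪ω, Du ω⟫ = ∫⟪curl ω, u × ω⟫`) pairs `curl ω`
with a field pointwise orthogonal to `ω`, so for every slice (`superhelicity_slack_stretching`)

  `(∫⟪ω, Du ω⟫)² ≤ ‖u‖²_∞ ‖ω‖₂² · (‖curl ω‖₂² − (∫⟪ω, curl ω⟫)²/‖ω‖₂²)`,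

the SUPERHELICITY `∫⟪ω, curl ω⟫` (Moffatt–Tsinober; `= −dH/dt /(2ν)`) being the blind component.
Combined with the stretching-number portrait of a singular time
(`frequently_stretching_gt_of_not_hasSmoothExtensionPast`: `∫⟪ω, Du ω⟫ > γ√(ν/(T−t))‖ω‖₂‖∇ω‖₂`
frequently, every `γ < 1`), a Type-I rate `√(T−t)‖u(t)‖_∞ ≤ C√ν` and `‖curl ω‖₂ = ‖∇ω‖₂`
(`div ω = 0`), this gives the kernel-checked PORTRAIT (`typeI_frequently_superhelicity_sq_lt`):

  at a Type-I(`C`) singular time, for every `γ ∈ [0,1)`, frequently as `t ↑ T`,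
  `C² (∫⟪ω, curl ω⟫)² < (C² − γ²) ‖ω‖₂² ‖curl ω‖₂²`,

i.e. the superhelicity correlation `σ(t) = ∫⟪ω, curl ω⟫/(‖ω‖₂‖curl ω‖₂)` satisfies
`liminf_{t↑T} σ(t)² ≤ 1 − 1/C²`: a Type-I blow-up at the ladder's reach `C ↓ 1` is asymptotically
superhelicity-free along a time sequence, and NO Type-I(`C`) blow-up keeps `|σ| > √(1 − 1/C²)` up to
`T`. Scale-invariant, sign-blind, DNS-measurable; complements the direction-coherence portraits of
route `ScaledTopAlignment` (p453776) on the 1217 side.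

WHAT THIS IS NOT: not a rung (`σ ≡ 0` is admissible), not a statement about Type-II. [folklore]

References: Farhat–Grujić, J. Nonlinear Sci. 29 (2019) = arXiv:1804.08238 §2; Moffatt–Tsinober,
Annu. Rev. Fluid Mech. 24 (1992); Lemarié-Rieusset 2016, Thm. 11.2.
-/

noncomputable section

open Set Filter Topology MeasureTheory
open scoped RealInnerProductSpace ENNReal NNReal Laplacian ContDiff
open Literature.Analysis.FluidPDE

namespace Summit.NavierStokesRegularity.NavierStokesRegularity.Theorems.DepletionLadder

-- the problem directory repeats the summit name (`NavierStokesRegularity/NavierStokesRegularity`)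
set_option linter.dupNamespace false

open Summit.NavierStokesRegularity.NavierStokesRegularity.Theorems.RungReynoldsOne
open Summit.NavierStokesRegularity.NavierStokesRegularity.Theorems.SimilarityEnstrophy

/-- **Superhelicity slack of the vortex stretching (one slice).** For a divergence-free
`v ∈ C³(ℝ³; ℝ³)` with `|v| ≤ M`, `‖Dv‖ ≤ B`, `Dv, D²v ∈ L²`, writing `ω = curl v`:
`(∫⟪ω, Dv ω⟫)² ≤ M² ‖ω‖₂² (‖curl ω‖₂² − (∫⟪ω, curl ω⟫)²/‖ω‖₂²)`. Proof: Lamb form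
`∫⟪ω, Dv ω⟫ = ∫⟪v × ω, curl ω⟫` (Farhat–Grujić identity), `v × ω ⊥ ω` pointwise, test against
`curl ω + μω` with `μ = −∫⟪ω, curl ω⟫/‖ω‖₂²`. [folklore] -/
theorem superhelicity_slack_stretching {v : EuclideanSpace ℝ (Fin 3) → EuclideanSpace ℝ (Fin 3)}
    (hv : ContDiff ℝ 3 v) (hdiv : VectorCalculus.IsDivFree v) {M B : ℝ} (hM : ∀ x, ‖v x‖ ≤ M)
    (hB : ∀ x, ‖fderiv ℝ v x‖ ≤ B)
    (h1 : ∫⁻ x, ‖iteratedFDeriv ℝ 1 v x‖ₑ ^ 2 < ⊤) (h2 : ∫⁻ x, ‖iteratedFDeriv ℝ 2 v x‖ₑ ^ 2 < ⊤) :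
    (∫ x, ⟪curl v x, fderiv ℝ v x (curl v x)⟫) ^ 2 ≤
      M ^ 2 * (∫ x, ‖curl v x‖ ^ 2) *
        ((∫ x, ‖curl (curl v) x‖ ^ 2) - (∫ x, ⟪curl v x, curl (curl v) x⟫) ^ 2 / ∫ x, ‖curl v x‖ ^ 2) := by
  set Z : ℝ := ∫ x, ‖curl v x‖ ^ 2 with hZ
  set W : ℝ := ∫ x, ‖curl (curl v) x‖ ^ 2 with hW
  set H : ℝ := ∫ x, ⟪curl v x, curl (curl v) x⟫ with hH'
  have hv2 : ContDiff ℝ 2 v := hv.of_le (by norm_cast)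
  have hv1 : ContDiff ℝ 1 v := hv.of_le (by norm_cast)
  have hM0 : 0 ≤ M := (norm_nonneg _).trans (hM 0)
  have hω2 : ContDiff ℝ 2 (curl v) := by
    rw [curl_eq_curlCLM_comp]
    exact curlCLM.contDiff.comp (hv.fderiv_right (m := 2) (by norm_cast))
  have hω1 : ContDiff ℝ 1 (curl v) := hω2.of_le (by norm_num)
  have cv : Continuous v := hv.continuous
  have cω : Continuous (curl v) := hω1.continuous
  have ccω : Continuous (curl (curl v)) := continuous_curl hω1
  have cDv : Continuous (fderiv ℝ v) := hv1.continuous_fderiv one_ne_zero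
  -- `L²` facts
  have nDv : ∀ x, ‖fderiv ℝ v x‖ ≤ ‖iteratedFDeriv ℝ 1 v x‖ := fun x => by
    rw [← norm_iteratedFDeriv_fderiv, norm_iteratedFDeriv_zero]
  have l2Dv : ∫⁻ x, ‖fderiv ℝ v x‖ₑ ^ 2 < ⊤ :=
    lintegral_enorm_sq_lt_top_of_norm_le (b := fun x => iteratedFDeriv ℝ 1 v x) nDv h1
  have hG : Integrable (fun x => ‖fderiv ℝ v x‖ ^ 2) volume :=
    integrable_sq_norm_of_lintegral_lt_top cDv l2Dv
  have cD2 : Continuous fun x => iteratedFDeriv ℝ 2 v x := hv.continuous_iteratedFDeriv (by norm_num)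
  have iD2 : Integrable (fun x => ‖iteratedFDeriv ℝ 2 v x‖ ^ 2) volume :=
    integrable_sq_norm_of_lintegral_lt_top cD2 h2
  have hH : Integrable (fun x => ‖fderiv ℝ (fderiv ℝ v) x‖ ^ 2) volume := by
    refine iD2.congr (Eventually.of_forall fun x => ?_)
    show ‖iteratedFDeriv ℝ 2 v x‖ ^ 2 = ‖fderiv ℝ (fderiv ℝ v) x‖ ^ 2
    rw [← norm_iteratedFDeriv_fderiv, norm_iteratedFDeriv_one]
  have l2ω : ∫⁻ x, ‖curl v x‖ₑ ^ 2 < ⊤ :=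
    lintegral_enorm_sq_lt_top_of_norm_le (b := fun x => ‖curlCLM‖ * ‖fderiv ℝ v x‖)
      (fun x => (norm_curl_le v x).trans (Real.le_norm_self _))
      (lintegral_enorm_sq_const_mul_norm_lt_top _ l2Dv)
  have l2Dω : ∫⁻ x, ‖fderiv ℝ (curl v) x‖ₑ ^ 2 < ⊤ :=
    lintegral_enorm_sq_lt_top_of_norm_le (b := fun x => ‖curlCLM‖ * ‖iteratedFDeriv ℝ 2 v x‖)
      (fun x => (norm_fderiv_curl_le hv2 x).trans (Real.le_norm_self _))
      (lintegral_enorm_sq_const_mul_norm_lt_top _ h2)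
  have l2cω : ∫⁻ x, ‖curl (curl v) x‖ₑ ^ 2 < ⊤ :=
    lintegral_enorm_sq_lt_top_of_norm_le (b := fun x => ‖curlCLM‖ * ‖fderiv ℝ (curl v) x‖)
      (fun x => (norm_curl_le (curl v) x).trans (Real.le_norm_self _))
      (lintegral_enorm_sq_const_mul_norm_lt_top _ l2Dω)
  have l2Mω : ∫⁻ x, ‖M * ‖curl v x‖‖ₑ ^ 2 < ⊤ := lintegral_enorm_sq_const_mul_norm_lt_top M l2ω
  have ccross : Continuous fun x => cross (v x) (curl v x) :=
    (crossCLM.continuous₂).comp (cv.prodMk cω) |>.congr (fun x => by simp [crossCLM_apply])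
  have hcr : ∀ x, ‖cross (v x) (curl v x)‖ ≤ ‖v x‖ * ‖curl v x‖ := fun x => by
    rw [norm_cross]
    nlinarith [Real.sin_le_one (InnerProductGeometry.angle (v x) (curl v x)),
      mul_nonneg (norm_nonneg (v x)) (norm_nonneg (curl v x))]
  have l2cross : ∫⁻ x, ‖cross (v x) (curl v x)‖ₑ ^ 2 < ⊤ := by
    refine lintegral_enorm_sq_lt_top_of_norm_le (b := fun x => M * ‖curl v x‖) (fun x => ?_) l2Mω
    exact ((hcr x).trans (mul_le_mul_of_nonneg_right (hM x) (norm_nonneg _))).trans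
      (Real.le_norm_self _)
  have mL : MemLp (fun x => cross (v x) (curl v x)) 2 volume :=
    (memLp_two_iff_integrable_sq_norm ccross.aestronglyMeasurable).2
      (integrable_sq_norm_of_lintegral_lt_top ccross l2cross)
  have mω : MemLp (curl v) 2 volume :=
    (memLp_two_iff_integrable_sq_norm cω.aestronglyMeasurable).2
      (integrable_sq_norm_of_lintegral_lt_top cω l2ω)
  have mcω : MemLp (curl (curl v)) 2 volume :=
    (memLp_two_iff_integrable_sq_norm ccω.aestronglyMeasurable).2
      (integrable_sq_norm_of_lintegral_lt_top ccω l2cω)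
  have isqω : Integrable (fun x => ‖curl v x‖ ^ 2) volume := integrable_sq_norm_of_lintegral_lt_top cω l2ω
  have isqcω : Integrable (fun x => ‖curl (curl v) x‖ ^ 2) volume :=
    integrable_sq_norm_of_lintegral_lt_top ccω l2cω
  have isqc : Integrable (fun x => ‖cross (v x) (curl v x)‖ ^ 2) volume :=
    integrable_sq_norm_of_lintegral_lt_top ccross l2cross
  have iH : Integrable (fun x => ⟪curl v x, curl (curl v) x⟫) volume :=
    integrable_of_norm_le_mul_of_lintegral_sq (cω.inner ccω).aestronglyMeasurable cω ccω l2ω l2cω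
      fun x => norm_inner_le_norm _ _
  -- Lamb form of the stretching
  have hJ : ∫ x, ⟪curl v x, fderiv ℝ v x (curl v x)⟫ =
      ∫ x, ⟪cross (v x) (curl v x), curl (curl v) x⟫ := by
    rw [FarhatGrujic2018.integral_stretching_eq_integral_inner_curl_cross hv2 hdiv hM hB hG hH]
    exact integral_congr_ae (Eventually.of_forall fun x => real_inner_comm _ _)
  have hZ0 : 0 ≤ Z := integral_nonneg fun x => sq_nonneg _
  -- `‖curl ω + μ ω‖₂² = W − H²/Z`
  set lam : ℝ := -(H / Z) with hlam
  have hX2 : ∫ x, ‖curl (curl v) x + lam • curl v x‖ ^ 2 = W - H ^ 2 / Z := by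
    have hexp : ∀ x, ‖curl (curl v) x + lam • curl v x‖ ^ 2 =
        ‖curl (curl v) x‖ ^ 2 + 2 * lam * ⟪curl v x, curl (curl v) x⟫ + lam ^ 2 * ‖curl v x‖ ^ 2 := by
      intro x
      rw [norm_add_sq_real, norm_smul, real_inner_smul_right, real_inner_comm, mul_pow,
        Real.norm_eq_abs, sq_abs]
      ring
    have hA : Integrable (fun x => ‖curl (curl v) x‖ ^ 2 + 2 * lam * ⟪curl v x, curl (curl v) x⟫)
        volume := isqcω.add (iH.const_mul (2 * lam))
    have hBB : Integrable (fun x => lam ^ 2 * ‖curl v x‖ ^ 2) volume := isqω.const_mul (lam ^ 2)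
    have hA2 : Integrable (fun x => 2 * lam * ⟪curl v x, curl (curl v) x⟫) volume :=
      iH.const_mul (2 * lam)
    rw [integral_congr_ae (Eventually.of_forall hexp), integral_add hA hBB, integral_add isqcω hA2,
      integral_const_mul, integral_const_mul]
    rcases eq_or_lt_of_le hZ0 with hZ00 | hZpos
    · have hl0 : lam = 0 := by rw [hlam, ← hZ00, div_zero, neg_zero]
      rw [hl0, ← hZ00]
      simp [hW]
    · rw [hlam]
      field_simp
      ring
  have hX0 : 0 ≤ W - H ^ 2 / Z := by
    rw [← hX2]; exact integral_nonneg fun x => sq_nonneg _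
  have hCS : |∫ x, ⟪cross (v x) (curl v x), curl (curl v) x⟫| ≤
      Real.sqrt (∫ x, ‖cross (v x) (curl v x)‖ ^ 2) * Real.sqrt (W - H ^ 2 / Z) := by
    rw [← hX2]
    exact abs_integral_inner_le_of_inner_eq_zero (fun x => inner_cross_curl_self _ _) mL mcω mω lam
  have ha20 : 0 ≤ ∫ x, ‖cross (v x) (curl v x)‖ ^ 2 := integral_nonneg fun x => sq_nonneg _
  have iMZ : Integrable (fun x => M ^ 2 * ‖curl v x‖ ^ 2) volume := isqω.const_mul _
  have ha2 : (∫ x, ‖cross (v x) (curl v x)‖ ^ 2) ≤ M ^ 2 * Z := by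
    rw [hZ, ← integral_const_mul]
    refine integral_mono isqc iMZ fun x => ?_
    calc ‖cross (v x) (curl v x)‖ ^ 2 ≤ (‖v x‖ * ‖curl v x‖) ^ 2 :=
          pow_le_pow_left₀ (norm_nonneg _) (hcr x) 2
      _ ≤ (M * ‖curl v x‖) ^ 2 := by gcongr; exact hM x
      _ = M ^ 2 * ‖curl v x‖ ^ 2 := by ring
  rw [hJ]
  have hsq := pow_le_pow_left₀ (abs_nonneg _) hCS 2
  rw [sq_abs, mul_pow, Real.sq_sqrt ha20, Real.sq_sqrt hX0] at hsq
  exact hsq.trans (mul_le_mul_of_nonneg_right ha2 hX0)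

/-- **Type-I portrait: frequently superhelicity-free up to `√(1 − 1/C²)`.** Let `u` be a classical
solution of the unforced Navier–Stokes system on `ℝ³ × [0,T)`, Leray–Hopf from its rapidly decaying
datum, with eventual Type-I rate `√(T−t)‖u(t,x)‖ ≤ C√ν`, which does NOT extend past `T`. Then for
every `γ ∈ [0, 1)`, at times accumulating at `T`,
`C²(∫⟪ω, curl ω⟫)² < (C² − γ²) ‖ω‖₂² ‖curl ω‖₂²` (`ω = curl u(t)`), i.e. the superhelicity
correlation `σ = ∫⟪ω, curl ω⟫/(‖ω‖₂‖curl ω‖₂)` has `liminf_{t↑T} σ² ≤ 1 − 1/C²`. Proof: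
`frequently_stretching_gt_of_not_hasSmoothExtensionPast` ∧ the rate, then at such a time
`γ²(ν/(T−t))‖ω‖₂²‖∇ω‖₂² < (∫⟪ω, Du ω⟫)² ≤ C²(ν/(T−t))‖ω‖₂²(‖curl ω‖₂² − (∫⟪ω,curl ω⟫)²/‖ω‖₂²)`
(`superhelicity_slack_stretching`) with `‖∇ω‖₂ = ‖curl ω‖₂`
(`integral_norm_curl_sq_eq_integral_frobeniusNormSq`, `div ω = 0`). [folklore] -/
theorem typeI_frequently_superhelicity_sq_lt {ν T C γ : ℝ} (hν : 0 < ν) (hT : 0 < T)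
    (hγ : 0 ≤ γ) (hγ1 : γ < 1)
    {u : ℝ → EuclideanSpace ℝ (Fin 3) → EuclideanSpace ℝ (Fin 3)}
    {p : ℝ → EuclideanSpace ℝ (Fin 3) → ℝ}
    (hsol : IsClassicalNSSolutionOn (Ico 0 T) ν 0 u p) (hLH : IsLerayHopfOn T ν 0 (u 0) u)
    (hdec : HasRapidSpatialDecay (u 0))
    (hrate : ∀ᶠ t in 𝓝[<] T, ∀ x, Real.sqrt (T - t) * ‖u t x‖ ≤ C * Real.sqrt ν)
    (hsing : ¬ HasSmoothExtensionPast ν 0 u T) :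
    ∃ᶠ t in 𝓝[<] T, C ^ 2 * (∫ x, ⟪curl (u t) x, curl (curl (u t)) x⟫) ^ 2 <
      (C ^ 2 - γ ^ 2) * (∫ x, ‖curl (u t) x‖ ^ 2) * ∫ x, ‖curl (curl (u t)) x‖ ^ 2 := by
  have hfreq := frequently_stretching_gt_of_not_hasSmoothExtensionPast hν hT hγ hγ1 hsol hLH hdec hsing
  have hIoo : ∀ᶠ t in 𝓝[<] T, t ∈ Ioo 0 T := Ioo_mem_nhdsLT hT
  refine ((hfreq.and_eventually (hrate.and hIoo))).mono ?_
  rintro t ⟨hJt, hratet, ht⟩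
  have hTt : 0 < T - t := sub_pos.2 ht.2
  -- Tao-class data at the slice `t`
  obtain ⟨q, hsolt, hut, -, -⟩ := stub_taoCover hν hT hsol hLH hdec ht
  have htI : t ∈ Icc 0 t := ⟨ht.1.le, le_rfl⟩
  obtain ⟨B₁, hB₁0, hB₁⟩ := exists_forall_norm_fderiv_le_of_hasBoundedSobolevNormsOn
    (fun s hs => (hsolt.contDiff_velocity hs).of_le (by norm_cast)) hut
  obtain ⟨D₁, hD₁⟩ := hut 1
  obtain ⟨D₂, hD₂⟩ := hut 2
  have hv3 : ContDiff ℝ 3 (u t) := (hsolt.contDiff_velocity htI).of_le (by norm_cast)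
  have hv2 : ContDiff ℝ 2 (u t) := hv3.of_le (by norm_cast)
  have hdivt : VectorCalculus.IsDivFree (u t) := hsolt.divFree t htI
  -- the Type-I sup bound at `t`
  set M : ℝ := C * Real.sqrt ν / Real.sqrt (T - t) with hMdef
  have hsT : 0 < Real.sqrt (T - t) := Real.sqrt_pos.2 hTt
  have hM : ∀ x, ‖u t x‖ ≤ M := fun x => by
    rw [hMdef, le_div_iff₀ hsT, mul_comm]
    exact hratet x
  have hM2 : M ^ 2 = C ^ 2 * (ν / (T - t)) := by
    rw [hMdef, div_pow, mul_pow, Real.sq_sqrt hν.le, Real.sq_sqrt hTt.le]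
    ring
  -- the slack at `t`
  have h1t : ∫⁻ x, ‖iteratedFDeriv ℝ 1 (u t) x‖ₑ ^ 2 < ⊤ := (hD₁ t htI).trans_lt ENNReal.coe_lt_top
  have h2t : ∫⁻ x, ‖iteratedFDeriv ℝ 2 (u t) x‖ₑ ^ 2 < ⊤ := (hD₂ t htI).trans_lt ENNReal.coe_lt_top
  have hslack := superhelicity_slack_stretching hv3 hdivt hM (hB₁ t htI) h1t h2t
  -- `∫|∇ω|²_F = ∫‖curl ω‖²`
  have hω2 : ContDiff ℝ 2 (curl (u t)) := by
    rw [curl_eq_curlCLM_comp]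
    exact curlCLM.contDiff.comp (hv3.fderiv_right (m := 2) (by norm_cast))
  have hω1 : ContDiff ℝ 1 (curl (u t)) := hω2.of_le (by norm_num)
  have cω : Continuous (curl (u t)) := hω1.continuous
  have cDω : Continuous (fderiv ℝ (curl (u t))) := hω1.continuous_fderiv one_ne_zero
  have hdivω : VectorCalculus.IsDivFree (curl (u t)) := fun x => divergence_curl_eq_zero_holds _ hv2 x
  have l2Dω : ∫⁻ x, ‖fderiv ℝ (curl (u t)) x‖ₑ ^ 2 < ⊤ :=
    lintegral_enorm_sq_lt_top_of_norm_le (b := fun x => ‖curlCLM‖ * ‖iteratedFDeriv ℝ 2 (u t) x‖)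
      (fun x => (norm_fderiv_curl_le hv2 x).trans (Real.le_norm_self _))
      (lintegral_enorm_sq_const_mul_norm_lt_top _ h2t)
  have l2Dv : ∫⁻ x, ‖fderiv ℝ (u t) x‖ₑ ^ 2 < ⊤ :=
    lintegral_enorm_sq_lt_top_of_norm_le (b := fun x => iteratedFDeriv ℝ 1 (u t) x) (fun x => by
      rw [← norm_iteratedFDeriv_fderiv, norm_iteratedFDeriv_zero]) h1t
  have l2ω : ∫⁻ x, ‖curl (u t) x‖ₑ ^ 2 < ⊤ :=
    lintegral_enorm_sq_lt_top_of_norm_le (b := fun x => ‖curlCLM‖ * ‖fderiv ℝ (u t) x‖)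
      (fun x => (norm_curl_le (u t) x).trans (Real.le_norm_self _))
      (lintegral_enorm_sq_const_mul_norm_lt_top _ l2Dv)
  have l2cω : ∫⁻ x, ‖curl (curl (u t)) x‖ₑ ^ 2 < ⊤ :=
    lintegral_enorm_sq_lt_top_of_norm_le (b := fun x => ‖curlCLM‖ * ‖fderiv ℝ (curl (u t)) x‖)
      (fun x => (norm_curl_le (curl (u t)) x).trans (Real.le_norm_self _))
      (lintegral_enorm_sq_const_mul_norm_lt_top _ l2Dω)
  have iF : Integrable (fun x => frobeniusNormSq (fderiv ℝ (curl (u t)) x)) volume := by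
    refine integrable_of_continuous_of_nonneg (continuous_frobeniusNormSq_fderiv hω1 one_ne_zero)
      (fun x => frobeniusNormSq_nonneg _) ?_
    exact (lintegral_ofReal_frobeniusNormSq_fderiv_curl_le hv2).trans_lt
      (ENNReal.mul_lt_top (ENNReal.mul_lt_top (by norm_num) ENNReal.ofReal_lt_top) h2t)
  have iC : Integrable (fun x => ‖curl (curl (u t)) x‖ ^ 2) volume :=
    integrable_sq_norm_of_lintegral_lt_top (continuous_curl hω1) l2cω
  have iT : Integrable (convect (curl (u t)) (curl (u t))) volume :=
    integrable_of_norm_le_mul_of_lintegral_sq (cDω.clm_apply cω).aestronglyMeasurable cDω cω l2Dω l2ω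
      fun x => (fderiv ℝ (curl (u t)) x).le_opNorm (curl (u t) x)
  have hWA : ∫ x, ‖curl (curl (u t)) x‖ ^ 2 = ∫ x, frobeniusNormSq (fderiv ℝ (curl (u t)) x) :=
    integral_norm_curl_sq_eq_integral_frobeniusNormSq hω2 hdivω iF iC iT
  -- combine
  rw [hM2, hWA] at hslack
  rw [hWA]
  have hZ0 : 0 ≤ ∫ x, ‖curl (u t) x‖ ^ 2 := integral_nonneg fun x => sq_nonneg _
  have hA0 : 0 ≤ ∫ x, frobeniusNormSq (fderiv ℝ (curl (u t)) x) :=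
    integral_nonneg fun x => frobeniusNormSq_nonneg _
  have hr0 : 0 < ν / (T - t) := div_pos hν hTt
  -- `γ² (ν/(T−t)) Z A < J²`
  have hlow : γ ^ 2 * (ν / (T - t)) * (∫ x, ‖curl (u t) x‖ ^ 2) *
      (∫ x, frobeniusNormSq (fderiv ℝ (curl (u t)) x)) <
      (∫ x, ⟪curl (u t) x, fderiv ℝ (u t) x (curl (u t) x)⟫) ^ 2 := by
    have hprod : 0 ≤ γ * Real.sqrt (ν / (T - t)) * Real.sqrt (∫ x, ‖curl (u t) x‖ ^ 2) *
        Real.sqrt (∫ x, frobeniusNormSq (fderiv ℝ (curl (u t)) x)) := by positivity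
    have hsq := pow_lt_pow_left₀ hJt hprod two_ne_zero
    rw [mul_pow, mul_pow, mul_pow, Real.sq_sqrt hr0.le, Real.sq_sqrt hZ0, Real.sq_sqrt hA0] at hsq
    exact hsq
  generalize (∫ x, ⟪curl (u t) x, fderiv ℝ (u t) x (curl (u t) x)⟫) = J at hlow hslack
  generalize (∫ x, ⟪curl (u t) x, curl (curl (u t)) x⟫) = H at hslack ⊢
  generalize (∫ x, ‖curl (u t) x‖ ^ 2) = Z at hlow hslack hZ0 ⊢
  generalize (∫ x, frobeniusNormSq (fderiv ℝ (curl (u t)) x)) = A at hlow hslack hA0 ⊢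
  generalize (ν / (T - t)) = r at hlow hslack hr0
  -- now pure real algebra: `γ² r Z A < J² ≤ C² r Z (A − H²/Z)`
  rcases eq_or_lt_of_le hZ0 with hZ00 | hZpos
  · exfalso
    rw [← hZ00] at hlow hslack
    simp only [mul_zero, zero_mul] at hlow hslack
    linarith
  have h3 : γ ^ 2 * r * Z * A < C ^ 2 * r * Z * (A - H ^ 2 / Z) := hlow.trans_le hslack
  have h4 : C ^ 2 * r * Z * (A - H ^ 2 / Z) = r * (C ^ 2 * (Z * A - H ^ 2)) := by
    field_simp
  have h5 : γ ^ 2 * r * Z * A = r * (γ ^ 2 * Z * A) := by ring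
  rw [h4, h5] at h3
  have hkey : γ ^ 2 * Z * A < C ^ 2 * (Z * A - H ^ 2) := lt_of_mul_lt_mul_left h3 hr0.le
  nlinarith [hkey]

/-- **Helical Type-I exclusion (the portrait read as a criterion).** A classical Leray–Hopf
rapidly-decaying-datum solution on `[0,T)` with eventual Type-I rate `√(T−t)‖u(t,x)‖ ≤ C√ν` whose
vorticity keeps, eventually, a superhelicity correlation `σ(t)² ≥ 1 − γ²/C²` for some `γ ∈ [0,1)` —
precisely `(C² − γ²) ‖ω‖₂² ‖curl ω‖₂² ≤ C² (∫⟪ω, curl ω⟫)²` for `t` near `T` — extends smoothly past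
`T`: persistently Beltrami-like vorticity (`|σ| ≥ σ₀`) is incompatible with a Type-I blow-up of
constant `C < 1/√(1 − σ₀²)`. Contrapositive of `typeI_frequently_superhelicity_sq_lt`. [folklore] -/
theorem hasSmoothExtensionPast_of_typeI_of_superhelicity {ν T C γ : ℝ} (hν : 0 < ν) (hT : 0 < T)
    (hγ : 0 ≤ γ) (hγ1 : γ < 1)
    {u : ℝ → EuclideanSpace ℝ (Fin 3) → EuclideanSpace ℝ (Fin 3)}
    {p : ℝ → EuclideanSpace ℝ (Fin 3) → ℝ}
    (hsol : IsClassicalNSSolutionOn (Ico 0 T) ν 0 u p) (hLH : IsLerayHopfOn T ν 0 (u 0) u)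
    (hdec : HasRapidSpatialDecay (u 0))
    (hrate : ∀ᶠ t in 𝓝[<] T, ∀ x, Real.sqrt (T - t) * ‖u t x‖ ≤ C * Real.sqrt ν)
    (hhel : ∀ᶠ t in 𝓝[<] T, (C ^ 2 - γ ^ 2) * (∫ x, ‖curl (u t) x‖ ^ 2) * (∫ x, ‖curl (curl (u t)) x‖ ^ 2) ≤
      C ^ 2 * (∫ x, ⟪curl (u t) x, curl (curl (u t)) x⟫) ^ 2) :
    HasSmoothExtensionPast ν 0 u T := by
  by_contra hsing
  have h := typeI_frequently_superhelicity_sq_lt hν hT hγ hγ1 hsol hLH hdec hrate hsing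
  have h' : ∃ᶠ t in 𝓝[<] T, False := (h.and_eventually hhel).mono fun t ht => by
    obtain ⟨hlt, hle⟩ := ht
    exact absurd hle (not_le.2 hlt)
  exact (Filter.frequently_false _) h'

end Summit.NavierStokesRegularity.NavierStokesRegularity.Theorems.DepletionLadder

end
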